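import Mathlib

/-!
# `stub_squeeze` (line `free-seed-smooth-rt`, Stub 3) is false without `Function.Injective Λ`

Refuter seat `refuter-drefute-stmt-Langlands-13757-0` (drefute), crux stmt-Langlands-13757.  Load-bearing
analysis of the Krull squeeze `S.stub_squeeze` of `Cruxes/MuOrdinaryFamilyRT/Lines/free-seed-smooth-rt.lean`:
the statement below is `S.stub_squeeze` VERBATIM with the single hypothesis `Function.Injective Λ` deleted,
and it is false — witness `𝒪 = ℤ₃`, `R = 𝒪⟦X,Y,Z⟧`, `s = id`, `T = R ⧸ ⊤ = 0`, `φ = Λ =` the quotient map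
(surjective, hence finite).  So injectivity of the weight map `Λ → T` (i.e. `T` not `Λ`-torsion, "the seed
makes `T_𝔪 ≠ 0`" in the host) is exactly what keeps the squeeze from collapsing; the other three hypotheses are
used in the obvious places (surjectivity of `s`, `φ`: take `R = T = 𝒪⟦X,Y,Z⟧ × 𝒪⟦X,Y,Z⟧` with diagonal maps;
finiteness of `Λ`: an Osgood-type injection `𝒪⟦x,y,z⟧ ↪ 𝒪⟦u,v⟧ ≅ 𝒪⟦x,y,z⟧/(z)`, not formalised here).
As typed (all four hypotheses) the stub is TRUE: `dim 𝒪⟦X,Y,Z⟧ = 4`, a finite injective `Λ` gives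
`dim T = 4`, and a surjection from a 4-dimensional Noetherian domain onto a ring of dimension 4 is injective.
-/

namespace Summit.Langlands.Langlands.Theorems.MuOrdinaryFamilyRT.Negative

set_option linter.dupNamespace false

open scoped Padic

/-- `S.stub_squeeze` of `Lines/free-seed-smooth-rt.lean` with `Function.Injective Λ →` deleted. -/
def StubSqueezeWithoutInjective : Prop :=
  ∀ (𝒪 : Type) [CommRing 𝒪] [IsDomain 𝒪] [IsDiscreteValuationRing 𝒪]
    (R T : Type) [CommRing R] [CommRing T] [Algebra 𝒪 R] [Algebra 𝒪 T]
    (s : MvPowerSeries (Fin 3) 𝒪 →ₐ[𝒪] R) (φ : R →ₐ[𝒪] T) (Λ : MvPowerSeries (Fin 3) 𝒪 →ₐ[𝒪] T),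
    Function.Surjective s → Function.Surjective φ → Λ.toRingHom.Finite →
    Function.Bijective s ∧ Function.Bijective φ

/-- **`stub_squeeze` is false without `Function.Injective Λ`**: the zero ring `T = 𝒪⟦X,Y,Z⟧ ⧸ ⊤` receives a
surjective (hence finite) `Λ` and a surjective `φ` which is not injective. [folklore] -/
theorem stub_squeeze_false_without_injective : ¬ StubSqueezeWithoutInjective := by
  intro h
  let P := MvPowerSeries (Fin 3) ℤ_[3]
  let q : P →ₐ[ℤ_[3]] P ⧸ (⊤ : Ideal P) := Ideal.Quotient.mkₐ ℤ_[3] ⊤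
  have hq : Function.Surjective q := Ideal.Quotient.mkₐ_surjective ℤ_[3] ⊤
  have hfin : q.toRingHom.Finite := RingHom.Finite.of_surjective _ hq
  obtain ⟨-, hφ⟩ := h ℤ_[3] P (P ⧸ (⊤ : Ideal P)) (AlgHom.id ℤ_[3] P) q q
    (fun x => ⟨x, rfl⟩) hq hfin
  have h10 : q 1 = q 0 := by
    simp only [map_one, map_zero]
    exact (Ideal.Quotient.eq_zero_iff_mem.mpr Submodule.mem_top : ((1 : P ⧸ (⊤ : Ideal P))) = 0)
  exact one_ne_zero (hφ.1 h10)

end Summit.Langlands.Langlands.Theorems.MuOrdinaryFamilyRT.Negative
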